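import Summits.HubbardSuperconductivity.HubbardSuperconductivity.Theses.LogColdTorus
import Summits.HubbardSuperconductivity.HubbardSuperconductivity.Theorems.BalabanIRBirEveryGroundState
import HarnessLib

/-!
# Route `LogColdTorus`, crux `AverageToEvery` (item `stmt-HubbardSuperconductivity-10519`, shared with route
`AbelianDuality`): the crux from an every-ground-state bound at one coupling (transfer closer)

Helper (`--supports`) for the crux
`Summit.HubbardSuperconductivity.HubbardSuperconductivity.Theses.LogColdTorus.AverageToEvery`.

* `averageToEvery_of_everyGroundState_transfer` — **`AverageToEvery` holds as soon as its window
  hypothesis (block ground-state average of `Δ_d† Δ_d` at least `c L⁴` on the window, eventually in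
  even `L`) yields ONE coupling `U` of the window and a constant `a > 0` with the every-ground-state
  bound `a L⁴ ≤ re ⟨ψ, Δ_d† Δ_d ψ⟩` for every normalised `(N_L, S^z = 0)`-sector ground state,
  eventually in even `L`.** The summit-format long-range order of every admissible sequence is then
  the landed `hasLRO_of_forall_groundState_bound` (sibling crux `BirEveryGroundState`). This is the
  operational content of the crux: every mechanism for "average → every" (Kato–Schur genericity,
  a κ-chord, uniqueness) has to produce exactly this bound at one coupling; the transfer itself is
  bookkeeping and is proved here once, in the crux's own (block) vocabulary.

Scalapino, Phys. Rep. 250 (1995) 329, §2; Tasaki (2020) §2.1. Folklore; no definition is introduced.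
-/

noncomputable section

-- `dupNamespace`: the summit and the problem are both named `HubbardSuperconductivity` (layout D-0022)
set_option linter.dupNamespace false

namespace Summit.HubbardSuperconductivity.HubbardSuperconductivity.Theorems

open Matrix Finset Filter
open Literature.Probability.LatticeModels Literature.MathematicalPhysics.QuantumLattice
open scoped ComplexOrder Matrix Classical

/-- **`AverageToEvery` from an every-ground-state bound at one coupling of the window** (transfer
closer). If for all data `(δ, U₁, U₂, c, L₀)` with `0 < U₁ < U₂`, `0 < c` the window hypothesis of
the crux (block ground-state average of `Δ_d† Δ_d` at least `c L⁴` for all `U ∈ (U₁, U₂)` and all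
even `L ≥ L₀`) yields a coupling `U ∈ (U₁, U₂)`, a constant `a > 0` and a threshold `L₁` such that
every normalised ground state `ψ` of `hubbardTorus 2 L 1 U` in the sector `(2⌊(1-δ)L²/2⌋, S^z = 0)`,
`L ≥ L₁` even, obeys `a L⁴ ≤ re ⟨ψ, Δ_d† Δ_d ψ⟩`, then `LogColdTorus.AverageToEvery` holds
(`hasLRO_of_forall_groundState_bound` supplies the long-range order of every admissible sequence).
Scalapino, Phys. Rep. 250 (1995) 329, §2 eq. (2.4). [folklore] -/
theorem averageToEvery_of_everyGroundState_transfer :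
    (∀ (δ U₁ U₂ c : ℝ) (L₀ : ℕ), 0 < U₁ → U₁ < U₂ → 0 < c →
      (∀ U ∈ Set.Ioo U₁ U₂, ∀ (L : ℕ) [NeZero L], L₀ ≤ L → Even L →
        c * (L : ℝ) ^ 4 ≤ (((hubbardTorus 2 L 1 U).toBlock
          (fun s : Finset (Orb (FermionTorus 2 L)) => s.card = 2 * ⌊(1 - δ) * (L : ℝ) ^ 2 / 2⌋₊ ∧
            2 * (s.filter fun i => (ofLex i).2 = 0).card = 2 * ⌊(1 - δ) * (L : ℝ) ^ 2 / 2⌋₊)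
          (fun s : Finset (Orb (FermionTorus 2 L)) => s.card = 2 * ⌊(1 - δ) * (L : ℝ) ^ 2 / 2⌋₊ ∧
            2 * (s.filter fun i => (ofLex i).2 = 0).card = 2 * ⌊(1 - δ) * (L : ℝ) ^ 2 / 2⌋₊)).groundStateFunctional
          ((((pairField dWaveFormFactor L)ᴴ * pairField dWaveFormFactor L)).toBlock
          (fun s : Finset (Orb (FermionTorus 2 L)) => s.card = 2 * ⌊(1 - δ) * (L : ℝ) ^ 2 / 2⌋₊ ∧
            2 * (s.filter fun i => (ofLex i).2 = 0).card = 2 * ⌊(1 - δ) * (L : ℝ) ^ 2 / 2⌋₊)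
          (fun s : Finset (Orb (FermionTorus 2 L)) => s.card = 2 * ⌊(1 - δ) * (L : ℝ) ^ 2 / 2⌋₊ ∧
            2 * (s.filter fun i => (ofLex i).2 = 0).card = 2 * ⌊(1 - δ) * (L : ℝ) ^ 2 / 2⌋₊))).re) →
      ∃ U ∈ Set.Ioo U₁ U₂, ∃ a : ℝ, 0 < a ∧ ∃ L₁ : ℕ, ∀ (L : ℕ) [NeZero L], L₁ ≤ L → Even L →
        ∀ ψ : Fock (Orb (FermionTorus 2 L)),
          IsGroundStateInSector (hubbardTorus 2 L 1 U) (2 * ⌊(1 - δ) * (L : ℝ) ^ 2 / 2⌋₊) 0 ψ →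
          star ψ ⬝ᵥ ψ = 1 →
          a * (L : ℝ) ^ 4 ≤
            (star ψ ⬝ᵥ ((pairField dWaveFormFactor L)ᴴ * pairField dWaveFormFactor L) *ᵥ ψ).re) →
    Summit.HubbardSuperconductivity.HubbardSuperconductivity.Theses.LogColdTorus.AverageToEvery := by
  intro htr δ U₁ U₂ c L₀ hU₁ hU₁₂ hc hyp
  obtain ⟨U, hU, a, ha, L₁, hL₁⟩ :=
    htr δ U₁ U₂ c L₀ hU₁ hU₁₂ hc (fun U hU L _ hL hLe => hyp U hU L hL hLe)
  exact ⟨U, hU, fun N ψ hadm =>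
    hasLRO_of_forall_groundState_bound U δ a ha L₁ (fun L _ hL hLe φ hgs hunit =>
      hL₁ L hL hLe φ hgs hunit) N ψ hadm⟩

end Summit.HubbardSuperconductivity.HubbardSuperconductivity.Theorems

end
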